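import Summits.BirchSwinnertonDyer.Rank1Residual.X1.UnrSeriesFirstUnitCoeff
import Literature.NumberTheory.EllipticCurves.KellerYin2024.AnomalousAnticyclotomicMainConjecture
import HarnessLib

/-!
# Keller–Yin Thm. 3.0.8 (IMC2) at the good lattice, READ AT `𝟙` — the INSIDE of the one preprint input
# `h308` of THEOREM A, typed as four named inputs + the algebra of `Λ_{R₀} = R₀⟦T⟧` IN THE KERNEL
# (cell `bsd-eis`, `run/shared/lean/pub/bsd-eis/`; seat `bsd-eis-ky` gen 5; HOME/bsd-eis-ky-MEMO-5-PLAN.md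
# §1 and HOME/bsd-eis-ky-MEMO-1.md §2 L5–L9, L11 — referee PASS, HOME/REF-VERDICT-ky-MEMO-1.md)

HONEST FRAMING (FULL-BSD rank-≤1 programme D-0033, row A1 = class X1 ∩ {`r_an = 1`, type A}: good
anomalous Eisenstein `p > 2`, 7 892 census cells). THEOREM A is in the kernel
(`X1/KellerYinTheoremAClass.lean`, p403478: `∀ W p, ClassX1 W p → ¬GVPar W p → r_an = 1 → BSDp W p`)
modulo registered PUBLISHED facts and exactly ONE preprint input,
`KellerYin2024.thm308_imc2_bdpValue_goodLattice_OPEN` (`h308`): Keller–Yin, arXiv:2402.12781v2,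
Thm. 3.0.8 (IMC2) for the good lattice at an anomalous prime, combined at the trivial character with
the Bertolini–Darmon–Prasanna formula ([CGLS] Thm. 5.1.3). Under D-0059 `h308` is crux rank 2
(`GoodLatticeBDPValue`) of the ledger route `EisensteinPrimes`. This file does NOT prove `h308` and
moves no label. It TYPES the inside of `h308` — the four links the cell's line-by-line verification
(MEMO-1 §2, referee PASS) isolates — as four named inputs, each with its print status, and PROVES in
the kernel that they imply `h308` (`thm308_of_halves`). The point: three of the four are PUBLISHED
statements ([CGLS] Thm. 2.1.1 existence; [CGLS] Thms. 4.1.1/3.2.1/4.1.3 + Prop. 4.2.1 one-sided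
divisibility under `E(K)[p] = 0`; [CGLS] Thm. 5.1.3 = BDP 2013 Thm. 5.13 value at `𝟙`), and the
fourth — `μ = 0` and `λ`-EQUALITY at an anomalous prime, Keller–Yin Thm. 1.5.1 + Thms. 2.2.1–2.2.3 —
is EXACTLY Keller–Yin's new content (the part OUR MEMO-1 §3A′/R2 re-derives from refereed inputs:
Rubin 1991, Hida 2010 μ = 0, de Shalit / Katz, Greenberg 1978, Perrin-Riou 1984, Kriz 2016). So the
preprint content of row A1 is confined to ONE `μ/λ` statement; nothing else changes.

## The four inputs (predicates on `(W, p)`, then quantified exactly like `h308`; nothing asserted)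

Common data (verbatim the binders of `h308`): `W` globally minimal, `2 < p`, `Good W p`, `Red W p`,
`Anom W p`, the good-lattice normalisation (no rational `p`-line unramified at `p`), `K` imaginary
quadratic with (Heeg) for `N_W` and for `p` (= `p` split), `D_K` odd `≠ −3`, `E(K)[p] = 0`,
`corank Sel_{p^∞}(E/K) = 1`, `ι : K → ℚ_p` with its prime `v`, `vbar ∋ p`, `vbar ≠ v`, `κ` anticyclotomic
with topological generator `γ`, `(N, Dt, H, ι_ℂ, P)` a modular parametrisation + Heegner datum with
Heegner point `P`; `𝔛 := AcSelmer.XAc (W.baseChange K) p κ vbar ∅ γ` ([CGLS] `𝔛_E`, strict at `v̄`);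
a FRAME = an embedding datum `ι' : ℚ̄_p ≃ ℂ` inducing `v` and `(Ω_K ≠ 0, Ω_p ∈ R₀ˣ, L ∈ R₀⟦T⟧)`
with `IsBDPLFunction ι' v κ γ Dt.f Ω_K Ω_p L` (the tree's characterisation of the BDP `p`-adic
`L`-function of `f_E` at the prime `v` of `ι`, Castella's normalisation; [CGLS] `𝓛_E = 𝓛_v`).

* `GoodBDPExistsOnTree` (H1, EXISTENCE) [PUB shape]: a frame exists. [CGLS] Thm. 2.1.1 (=
  Bertolini–Darmon–Prasanna 2013 §5 / Castella–Hsieh 2018 Def. 3.5–Prop. 3.6: "odd `p ∤ N` split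
  in `K`", NO image hypothesis). The tree's registered existence fact
  `castella2018_exists_isBDPLFunction` is scoped `p ≥ 5`, `ρ̄` irreducible (Castella 2018 §2.1) and
  does NOT serve here; the class X2 twin discharges H1 from Hsieh 2014 + a residual
  (`X2/NonsplitBDPExists.lean`). Typed, not attempted.
* `GoodLatticeDivOnTree` (L-div, ONE DIVISIBILITY) [PUB∘ = composition of refereed statements,
  MEMO-1 L5 + L6 + L8]: `𝔛` is `Λ`-torsion and `p^k · L ∈ char_Λ(𝔛) · R₀⟦T⟧` for some `k ≥ 0`
  ("`char_Λ(𝔛_E)Λ^ur ⊇ (𝓛_E)` in `Λ^ur[1/p]`"): Heegner-point Kolyvagin system on the good lattice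
  ([CGLS] Thm. 4.1.1 + Rem. 4.1.2 = Howard 2004 with `E(K)[p] = 0` replacing surjectivity;
  Cornut–Vatsal), Howard's structure theorem ([CGLS] Thm. 3.2.1 / Cor. 3.2.2 / Thm. 4.1.3 under (h1)
  `E(K)[p] = 0`), and the equivalence of divisibilities IMC1 ⇔ IMC2 after inverting `p` ([CGLS]
  Prop. 4.2.1 = Burungale–Castella–Kim 2021 Thm. 5.2). The anomaly of `p` plays no role in any of them
  (MEMO-1 L8: `(T⁻)^{G_{K_∞,v̄}} = 0` since the unit root is not a root of unity).
* `GoodLatticeMuLambdaOnTree` (L-μλ) [PRE — Keller–Yin's NEW CONTENT]: for every generator `𝓕` of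
  `char_Λ(𝔛)` and every frame `L`: `μ(𝓕) = μ(L) = 0` and `λ(𝓕) = λ(L)`, stated coefficientwise
  (the first unit coefficient of `𝓕` (read in `R₀`) and of `L` sit at the same
  index `n`, stated coefficientwise: `‖[Tⁿ]·‖ = 1 ∧ ∀ i < n, ‖[Tⁱ]·‖ < 1` — by Weierstrass preparation
  over `ℤ_p` / `R₀ = W(𝔽̄_p)` this is `μ = 0 ∧ λ = n` on both sides). KY Thm. 1.5.1 (`algmain`: `μ(𝔛_f) = 0`, `λ(𝔛_f) = Σ λ(character Selmer groups) + local
  terms`) + Thms. 2.2.1–2.2.3 (`anacong`/`anacomp`: `μ(𝓛_f) = 0`, the same count for `λ(𝓛_f)`),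
  assembled in KY's proof of Thm. 3.0.8 (v2 TeX L1631–L1640: "equality by `algmain` + `anacomp`") =
  the anomalous case of [CGLS] Thm. 2.2.4 `mulambda`. [claim: KellerYin2024, status: under-review]
* `GoodBDPValueOnTree` (L-val, VALUE AT `𝟙`) [PUB shape]: `L(𝟙) = w · c_E⁻² (1 − a_p p⁻¹ + p⁻¹)²
  (log_{ω_E} P)²`, `w ∈ R₀ˣ` — [CGLS] Thm. 5.1.3 = BDP 2013 Thm. 5.13 / Castella–Hsieh 2018 ("let
  `p > 2` be a prime of good reduction … `p = v v̄` splits in `K`"; no condition on the isogeny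
  characters; at an anomalous `p` the Euler factor is a `p`-adic integer of valuation
  `ord_p(1 − a_p + p) − 1`, just a number).

Plus the intermediate shape `GoodLatticeIMCEqOnTree` = KY Thm. 3.0.8 (IMC2) PROPER (equality of
ideals of `R₀⟦T⟧`, no value; class-X1 twin of class X2's `NonsplitIMCEqOnTree`), with
`goodLatticeIMCEqOnTree_of_div_of_muLambda` (L-div + L-μλ ⟹ IMC2, KY's printed proof) and
`thm308_of_imcEq` (H1 + IMC2 + L-val ⟹ `h308`).

## What is PROVED here (kernel)

**`thm308_of_halves`**: H1 → L-div → L-μλ → L-val → `h308`, by the algebra of the companion file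
`X1/UnrSeriesFirstUnitCoeff.lean` (MEMO-1 L9 verbatim: `p^k 𝓛 = 𝓕·G`, `μ(𝓕) = 0` forces `p^k ∣ G`, so
`𝓛 = 𝓕·G'`; `λ(𝓕) = λ(𝓛)` forces `λ(G') = 0 = μ(G')`, so `G'` is a unit and `(𝓕)R₀⟦T⟧ = (𝓛)`;
then `𝓕(0) = u·𝓛(0)` read back in `ℚ_p` with `u ∈ ℤ_pˣ`, [CGLS] (5.4)) and the principality of
characteristic ideals of `Λ`-modules (tree: `charIdeal_isPrincipal_holds`).

## What this is NOT

Not a proof of `h308`, not a label move, not a new route: the four inputs are HYPOTHESES BY NAME.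
Not a claim that L-div / L-val are registered Literature facts (they are typed HERE, on the Summits
side, with their locators, like class X2's `NonsplitBDPValueOnTree` / `NonsplitIMCEqOnTree`; moving
them under `Literature/` is the planner's / librarian's call). The dictionary (which prime carries the
frame, which the Selmer condition) is `h308`'s own: frame at the prime `v` of `ι` ([CGLS] `ι_p ↦ v`,
`𝓛_v`), `𝔛` strict at `v̄` ([CGLS] `𝓕_Gr`); any two frames of the same `(ι', v, κ, γ, f)` generate
the same ideal of `R₀⟦T⟧` (tree: `X11b.R1.span_singleton_eq_of_isBDPLFunction`), so the ∀-over-frames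
statements do not depend on the periods.

References: [KellerYin2024] Thm. 3.0.8 (IMC2), Thm. 1.5.1, Thms. 2.2.1–2.2.3, §1.4;
[CastellaGrossiLeeSkinner2022] Thms. 2.1.1, 2.2.4, 3.2.1, 4.1.1, 4.1.3, Prop. 4.2.1, Thm. 5.1.3,
(5.4); [BertoliniDarmonPrasanna2013] Thm. 5.13; [BurungaleCastellaKim2021] Thm. 5.2;
[Howard2004] Thms. 1–2; [Washington1997] §7.1 Prop. 7.2, §13.2; HOME/bsd-eis-ky-MEMO-1.md §2–§3,
MEMO-5-PLAN §1–§2.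
-/

set_option autoImplicit false

noncomputable section

open scoped Classical

open PowerSeries WeierstrassCurve NumberField IsDedekindDomain Field
  Literature.NumberTheory.EllipticCurves Literature.NumberTheory.EllipticCurves.ModularForms
  Literature.NumberTheory.QuadraticFields Literature.NumberTheory.EllipticCurves.Rank1Residual
  Literature.NumberTheory.EllipticCurves.Castella2018
  Literature.NumberTheory.EllipticCurves.KellerYin2024
  Summit.BirchSwinnertonDyer.Rank1Residual.X11b.Halves

namespace Summit.BirchSwinnertonDyer.Rank1Residual.X1.KellerYinHalves

/-! ## §1 The four typed inputs (predicates on `(W, p)` with `h308`'s binders; nothing asserted) -/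

section Shapes

variable (W : WeierstrassCurve ℚ) [W.IsElliptic] [W.IsGloballyMinimal] (p : ℕ) [Fact p.Prime]

/-- **H1 — EXISTENCE of the BDP `p`-adic `L`-function of `f_E` at the prime `v` of `ι`, as a frame
`IsBDPLFunction ι' v κ γ Dt.f Ω_K Ω_p L` with an embedding datum `ι' : ℚ̄_p ≃ ℂ` inducing `v`**, on
the data of `h308`. PRINT: [CGLS] Thm. 2.1.1 ("`𝓛_E ∈ Λ^ur`", `p = v v̄` split, (Heeg); from
Bertolini–Darmon–Prasanna 2013 §5 and Castella–Hsieh 2018 Def. 3.5 / Prop. 3.6, "odd `p ∤ N`"; NO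
hypothesis on `ρ̄_{E,p}`). The tree's `castella2018_exists_isBDPLFunction` is the same existence
statement scoped `p ≥ 5`, squarefree `N`, `ρ̄` irreducible (Castella 2018 §2.1) — not usable on
class X1; the class-X2 analogue is discharged from Hsieh 2014 + `HsiehFrameResidualAt`
(`X2/NonsplitBDPExists.lean`). A PUB-shaped input; TYPED, not attempted; nothing asserted.
[cite: CastellaGrossiLeeSkinner2022, Thm. 2.1.1 (shape only; nothing asserted)]
[cite: CastellaHsieh2018, Def. 3.5 and Prop. 3.6 (shape only; nothing asserted)] -/
@[conjecture]
def GoodBDPExistsOnTree : Prop :=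
    2 < p → Good W p → Red W p → Anom W p →
    (∀ Φ : AddSubgroup (geomTorsion W (p : ℤ)), IsRationalLine W p Φ → ¬ LineUnramifiedAt W p Φ) →
    ∀ (K : Type) [Field K] [NumberField K], IsImaginaryQuadratic K →
      SatisfiesHeegnerHypothesis (W.conductorNorm ℤ) K → SatisfiesHeegnerHypothesis p K →
      Odd (NumberField.discr K) → NumberField.discr K ≠ -3 →
      (∀ Q : (W.baseChange K).toAffine.Point, p • Q = 0 → Q = 0) →
      (W.baseChange K).selmerCorank p = 1 →
    ∀ (ι : K →+* ℚ_[p]) (v vbar : HeightOneSpectrum (𝓞 K)),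
      (∀ x : 𝓞 K, x ∈ v.asIdeal ↔ ‖ι (x : K)‖ < 1) →
      ((p : ℕ) : 𝓞 K) ∈ vbar.asIdeal → vbar ≠ v →
    ∀ (κ : ZpExtension K p), κ.IsAnticyclotomic →
    ∀ (γ : absoluteGaloisGroup K) [Fact (κ.IsTopGenerator γ)],
    ∀ (N : ℕ) [NeZero N] (Dt : ModularParametrizationData W N)
      (H : HeegnerDatum N (NumberField.discr K)) (ιC : K →+* ℂ) (P : (W.baseChange K).toAffine.Point),
      WeierstrassCurve.Affine.Point.map ιC.toRatAlgHom P = heegnerPointComplex Dt H →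
    ∃ ι' : PadicAlgCl p ≃+* ℂ,
      (∀ (w : InfinitePlace K) (k : 𝓞 K), k ∈ v.asIdeal ↔ ‖ι'.symm (w.embedding (k : K))‖ < 1) ∧
      ∃ (ΩK : ℂ) (Ωp : (unrIntegers p)ˣ) (L : UnrSeries p),
        ΩK ≠ 0 ∧ IsBDPLFunction ι' v κ γ Dt.f ΩK ((Ωp : unrIntegers p) : ℂ_[p]) L

/-- **L-div — ONE DIVISIBILITY in (IMC2) for the good lattice, after inverting `p`**, on the data of
`h308` and every frame: `𝔛 = X_ac^∅(E/K_∞)` (strict at `v̄`) is `Λ`-torsion and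
`p^k · L ∈ char_Λ(𝔛) · R₀⟦T⟧` for some `k` ("`char_Λ(𝔛_E)Λ^ur ⊇ (𝓛_E)` in `Λ^ur[1/p]`", MEMO-1 L8).
PRINT (PUB∘, MEMO-1 L5 + L6 + L8, referee PASS): the Heegner-point Kolyvagin system on the good
lattice — [CGLS] Thm. 4.1.1 + Rem. 4.1.2 (= Howard, Compos. Math. 140 (2004) Thms. 1–2 with
`E(K)[p] = 0` replacing surjectivity, [CGLS] TeX L2203–L2208; Cornut–Vatsal non-triviality); Howard's
structure theorem [CGLS] Thm. 3.2.1 / Cor. 3.2.2 / Thm. 4.1.3 under (h1) `E(K)[p] = 0` (no condition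
on `φ|_{G_p}`; the scalar `u·1 ∈ ρ(G_{K_∞})` exists for non-CM `E`, MEMO-1 L6); and [CGLS]
Prop. 4.2.1 (= Burungale–Castella–Kim 2021 Thm. 5.2): the IMC1 divisibility ⟺ `𝔛` torsion with the
IMC2 divisibility in `Λ^ur[1/p]`. The anomaly of `p` enters none of them. A PUB∘-shaped input;
TYPED, not attempted; nothing asserted. [cite: CastellaGrossiLeeSkinner2022, Thm. 4.1.1, Rem. 4.1.2, Thm. 3.2.1, Cor. 3.2.2, Thm. 4.1.3, Prop. 4.2.1 (shape only; nothing asserted)]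
[cite: Howard2004, Thms. 1–2 (arXiv:1202.6340)] [cite: BurungaleCastellaKim2021, Thm. 5.2] -/
@[conjecture]
def GoodLatticeDivOnTree : Prop :=
    2 < p → Good W p → Red W p → Anom W p →
    (∀ Φ : AddSubgroup (geomTorsion W (p : ℤ)), IsRationalLine W p Φ → ¬ LineUnramifiedAt W p Φ) →
    ∀ (K : Type) [Field K] [NumberField K], IsImaginaryQuadratic K →
      SatisfiesHeegnerHypothesis (W.conductorNorm ℤ) K → SatisfiesHeegnerHypothesis p K →
      Odd (NumberField.discr K) → NumberField.discr K ≠ -3 →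
      (∀ Q : (W.baseChange K).toAffine.Point, p • Q = 0 → Q = 0) →
      (W.baseChange K).selmerCorank p = 1 →
    ∀ (ι : K →+* ℚ_[p]) (v vbar : HeightOneSpectrum (𝓞 K)),
      (∀ x : 𝓞 K, x ∈ v.asIdeal ↔ ‖ι (x : K)‖ < 1) →
      ((p : ℕ) : 𝓞 K) ∈ vbar.asIdeal → vbar ≠ v →
    ∀ (κ : ZpExtension K p), κ.IsAnticyclotomic →
    ∀ (γ : absoluteGaloisGroup K) [Fact (κ.IsTopGenerator γ)],
    ∀ (N : ℕ) [NeZero N] (Dt : ModularParametrizationData W N)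
      (H : HeegnerDatum N (NumberField.discr K)) (ιC : K →+* ℂ) (P : (W.baseChange K).toAffine.Point),
      WeierstrassCurve.Affine.Point.map ιC.toRatAlgHom P = heegnerPointComplex Dt H →
    ∀ (ι' : PadicAlgCl p ≃+* ℂ),
      (∀ (w : InfinitePlace K) (k : 𝓞 K), k ∈ v.asIdeal ↔ ‖ι'.symm (w.embedding (k : K))‖ < 1) →
    ∀ (ΩK : ℂ) (Ωp : (unrIntegers p)ˣ) (L : UnrSeries p), ΩK ≠ 0 →
      IsBDPLFunction ι' v κ γ Dt.f ΩK ((Ωp : unrIntegers p) : ℂ_[p]) L →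
    Module.IsTorsion (IwasawaAlgebra p) (Castella2018.AcSelmer.XAc (W.baseChange K) p κ vbar ∅ γ) ∧
      ∃ k : ℕ, C ((p : unrIntegers p) ^ k) * L ∈
        (Castella2018.AcSelmer.XAc.charIdeal (W.baseChange K) p κ vbar ∅ γ).map (PowerSeries.map (toUnr p))

/-- **L-μλ — KELLER–YIN'S NEW CONTENT: `μ = 0` and `λ`-EQUALITY at an anomalous prime**, on the data
of `h308`, every generator `𝓕` of `char_Λ(𝔛)` and every frame `L`: the first unit coefficient of `𝓕`
(read in `R₀ ⊇ ℤ_p`) and that of `L` sit at the SAME index `n` — i.e. `μ(𝔛) = μ(𝓕) = 0 = μ(L)` and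
`λ(𝔛) = λ(𝓕) = n = λ(L)` (Weierstrass preparation over `ℤ_p` and over `R₀ = W(𝔽̄_p)`; `μ`, `λ` of
the torsion `Λ`-module `𝔛` are those of a characteristic power series). PRINT: Keller–Yin,
arXiv:2402.12781v2 — Thm. 1.5.1 (`algmain`: `μ(𝔛_f) = 0` and the `λ`-count of `𝔛_f` from the two
character Selmer groups, anomalous local terms by §1.4 Cases I–III), Thms. 2.2.1–2.2.3
(`anacong`/`anacomp`: `μ(𝓛_f) = 0` by Hida / Hsieh, the same count for `λ(𝓛_f)` from the Katz/BDP
congruence and the two-variable bridge), combined in the proof of Thm. 3.0.8 (TeX L1631–L1640,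
"equality by `algmain` + `anacomp`") — the anomalous case of [CGLS] Thm. 2.2.4 (`mulambda`). UNREFEREED
PREPRINT: this is THE preprint content of row A1 (the cell's audit: MEMO-1 §3 — KY's printed Case-I
local row, v2 TeX L1202, is false but void for non-CM `E`; OUR uniform derivation §3A′ and the
two-variable descent R2 replace KY's case split and wrong-tower citations; referee PASS). NEVER cite
this `Prop` as a theorem. [claim: KellerYin2024, status: under-review]
[cite: KellerYin2024, Thm. 1.5.1, Thms. 2.2.1–2.2.3, proof of Thm. 3.0.8 (arXiv:2402.12781v2 TeX L1631–L1640)]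
[cite: CastellaGrossiLeeSkinner2022, Thm. 2.2.4 (the non-anomalous twin, shape)]
[cite: Washington1997, §7.1 Prop. 7.2, §13.2 (μ, λ as first unit coefficient)] -/
@[conjecture]
def GoodLatticeMuLambdaOnTree : Prop :=
    2 < p → Good W p → Red W p → Anom W p →
    (∀ Φ : AddSubgroup (geomTorsion W (p : ℤ)), IsRationalLine W p Φ → ¬ LineUnramifiedAt W p Φ) →
    ∀ (K : Type) [Field K] [NumberField K], IsImaginaryQuadratic K →
      SatisfiesHeegnerHypothesis (W.conductorNorm ℤ) K → SatisfiesHeegnerHypothesis p K →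
      Odd (NumberField.discr K) → NumberField.discr K ≠ -3 →
      (∀ Q : (W.baseChange K).toAffine.Point, p • Q = 0 → Q = 0) →
      (W.baseChange K).selmerCorank p = 1 →
    ∀ (ι : K →+* ℚ_[p]) (v vbar : HeightOneSpectrum (𝓞 K)),
      (∀ x : 𝓞 K, x ∈ v.asIdeal ↔ ‖ι (x : K)‖ < 1) →
      ((p : ℕ) : 𝓞 K) ∈ vbar.asIdeal → vbar ≠ v →
    ∀ (κ : ZpExtension K p), κ.IsAnticyclotomic →
    ∀ (γ : absoluteGaloisGroup K) [Fact (κ.IsTopGenerator γ)],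
    ∀ (N : ℕ) [NeZero N] (Dt : ModularParametrizationData W N)
      (H : HeegnerDatum N (NumberField.discr K)) (ιC : K →+* ℂ) (P : (W.baseChange K).toAffine.Point),
      WeierstrassCurve.Affine.Point.map ιC.toRatAlgHom P = heegnerPointComplex Dt H →
    ∀ (ι' : PadicAlgCl p ≃+* ℂ),
      (∀ (w : InfinitePlace K) (k : 𝓞 K), k ∈ v.asIdeal ↔ ‖ι'.symm (w.embedding (k : K))‖ < 1) →
    ∀ (ΩK : ℂ) (Ωp : (unrIntegers p)ˣ) (L : UnrSeries p), ΩK ≠ 0 →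
      IsBDPLFunction ι' v κ γ Dt.f ΩK ((Ωp : unrIntegers p) : ℂ_[p]) L →
    ∀ F : IwasawaAlgebra p,
      Castella2018.AcSelmer.XAc.charIdeal (W.baseChange K) p κ vbar ∅ γ = Ideal.span {F} →
      ∃ n : ℕ,
        (‖((PowerSeries.coeff n (PowerSeries.map (toUnr p) F) : unrIntegers p) : ℂ_[p])‖ = 1 ∧
          ∀ i < n, ‖((PowerSeries.coeff i (PowerSeries.map (toUnr p) F) : unrIntegers p) : ℂ_[p])‖ < 1) ∧
        (‖((PowerSeries.coeff n L : unrIntegers p) : ℂ_[p])‖ = 1 ∧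
          ∀ i < n, ‖((PowerSeries.coeff i L : unrIntegers p) : ℂ_[p])‖ < 1)

/-- **L-val — the VALUE AT `𝟙` (Bertolini–Darmon–Prasanna)**, on the data of `h308` and every frame:
`L(𝟙) = w · c_E⁻² · (1 − a_p p⁻¹ + p⁻¹)² · (log_{ω_E} P)²` with `w ∈ R₀ˣ`, `c_E = Dt.c` the Manin
constant of the parametrisation, `a_p = W.frobeniusTrace p`, `log_{ω_E} P = log_Ê([m₀]P_ι)/m₀` through `ι`,
i.e. at `v` (verbatim `h308`'s expression; definitionally the tree's `X11b.Halves.logOmega W p ι P`). PRINT: [CGLS] Thm. 5.1.3 (TeX `thmpadicGZ`,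
L2463–L2471, with §5.1.2) = Bertolini–Darmon–Prasanna 2013 Thm. 5.13 / Castella–Hsieh 2018 — "let
`p > 2` be a prime of good reduction for `E` such that `p = v v̄` splits in `K`"; NO condition on the
isogeny characters, so the anomalous case is covered verbatim (MEMO-1 L11). A PUB-shaped input;
TYPED, not attempted; nothing asserted.
[cite: CastellaGrossiLeeSkinner2022, Thm. 5.1.3 with §5.1.2 (shape only; nothing asserted)]
[cite: BertoliniDarmonPrasanna2013, Thm. 5.13 (shape only; nothing asserted)] -/
@[conjecture]
def GoodBDPValueOnTree : Prop :=
    2 < p → Good W p → Red W p → Anom W p →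
    (∀ Φ : AddSubgroup (geomTorsion W (p : ℤ)), IsRationalLine W p Φ → ¬ LineUnramifiedAt W p Φ) →
    ∀ (K : Type) [Field K] [NumberField K], IsImaginaryQuadratic K →
      SatisfiesHeegnerHypothesis (W.conductorNorm ℤ) K → SatisfiesHeegnerHypothesis p K →
      Odd (NumberField.discr K) → NumberField.discr K ≠ -3 →
      (∀ Q : (W.baseChange K).toAffine.Point, p • Q = 0 → Q = 0) →
      (W.baseChange K).selmerCorank p = 1 →
    ∀ (ι : K →+* ℚ_[p]) (v vbar : HeightOneSpectrum (𝓞 K)),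
      (∀ x : 𝓞 K, x ∈ v.asIdeal ↔ ‖ι (x : K)‖ < 1) →
      ((p : ℕ) : 𝓞 K) ∈ vbar.asIdeal → vbar ≠ v →
    ∀ (κ : ZpExtension K p), κ.IsAnticyclotomic →
    ∀ (γ : absoluteGaloisGroup K) [Fact (κ.IsTopGenerator γ)],
    ∀ (N : ℕ) [NeZero N] (Dt : ModularParametrizationData W N)
      (H : HeegnerDatum N (NumberField.discr K)) (ιC : K →+* ℂ) (P : (W.baseChange K).toAffine.Point),
      WeierstrassCurve.Affine.Point.map ιC.toRatAlgHom P = heegnerPointComplex Dt H →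
    ∀ (ι' : PadicAlgCl p ≃+* ℂ),
      (∀ (w : InfinitePlace K) (k : 𝓞 K), k ∈ v.asIdeal ↔ ‖ι'.symm (w.embedding (k : K))‖ < 1) →
    ∀ (ΩK : ℂ) (Ωp : (unrIntegers p)ˣ) (L : UnrSeries p), ΩK ≠ 0 →
      IsBDPLFunction ι' v κ γ Dt.f ΩK ((Ωp : unrIntegers p) : ℂ_[p]) L →
    ∃ w : (unrIntegers p)ˣ, L.HasValueAt 0 (((w : unrIntegers p) : ℂ_[p]) *
      algebraMap ℚ_[p] ℂ_[p] (((Dt.c : ℚ_[p])⁻¹) ^ 2 *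
        (1 - (W.frobeniusTrace p : ℚ_[p]) * (p : ℚ_[p])⁻¹ + (p : ℚ_[p])⁻¹) ^ 2 *
        ((W.baseChange ℚ_[p]).padicLogPoint (formalIndex W p • padicPointOf W p ι P) /
          (formalIndex W p : ℚ_[p])) ^ 2))


/-- **(IMC2) PROPER for the good lattice — Keller–Yin Thm. 3.0.8 (IMC2) as an EQUALITY of ideals of
`Λ_{R₀} = R₀⟦T⟧`**, on the data of `h308` and every frame `L`: `𝔛` is `Λ`-torsion and
`char_Λ(𝔛) · R₀⟦T⟧ = (L)` ("`Char_Λ(𝔛_f)Λ^nr = (𝓛_f)` holds in `Λ^nr`", KY v2 TeX L1618–L1629), the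
value at `𝟙` NOT included. The class-X1 twin of class X2's `NonsplitIMCEqOnTree` / route R1's
`R1.IMCEqOnTreeAt`. By `goodLatticeIMCEqOnTree_of_div_of_muLambda` below it FOLLOWS from L-div (PUB∘)
and L-μλ (PRE), which is exactly KY's printed proof (L1631–L1640). UNREFEREED PREPRINT as a citation;
NEVER cite this `Prop` as a theorem. [claim: KellerYin2024, status: under-review]
[cite: KellerYin2024, Thm. 3.0.8 (IMC2) (arXiv:2402.12781v2 TeX L1618–L1640)] -/
@[conjecture]
def GoodLatticeIMCEqOnTree : Prop :=
    2 < p → Good W p → Red W p → Anom W p →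
    (∀ Φ : AddSubgroup (geomTorsion W (p : ℤ)), IsRationalLine W p Φ → ¬ LineUnramifiedAt W p Φ) →
    ∀ (K : Type) [Field K] [NumberField K], IsImaginaryQuadratic K →
      SatisfiesHeegnerHypothesis (W.conductorNorm ℤ) K → SatisfiesHeegnerHypothesis p K →
      Odd (NumberField.discr K) → NumberField.discr K ≠ -3 →
      (∀ Q : (W.baseChange K).toAffine.Point, p • Q = 0 → Q = 0) →
      (W.baseChange K).selmerCorank p = 1 →
    ∀ (ι : K →+* ℚ_[p]) (v vbar : HeightOneSpectrum (𝓞 K)),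
      (∀ x : 𝓞 K, x ∈ v.asIdeal ↔ ‖ι (x : K)‖ < 1) →
      ((p : ℕ) : 𝓞 K) ∈ vbar.asIdeal → vbar ≠ v →
    ∀ (κ : ZpExtension K p), κ.IsAnticyclotomic →
    ∀ (γ : absoluteGaloisGroup K) [Fact (κ.IsTopGenerator γ)],
    ∀ (N : ℕ) [NeZero N] (Dt : ModularParametrizationData W N)
      (H : HeegnerDatum N (NumberField.discr K)) (ιC : K →+* ℂ) (P : (W.baseChange K).toAffine.Point),
      WeierstrassCurve.Affine.Point.map ιC.toRatAlgHom P = heegnerPointComplex Dt H →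
    ∀ (ι' : PadicAlgCl p ≃+* ℂ),
      (∀ (w : InfinitePlace K) (k : 𝓞 K), k ∈ v.asIdeal ↔ ‖ι'.symm (w.embedding (k : K))‖ < 1) →
    ∀ (ΩK : ℂ) (Ωp : (unrIntegers p)ˣ) (L : UnrSeries p), ΩK ≠ 0 →
      IsBDPLFunction ι' v κ γ Dt.f ΩK ((Ωp : unrIntegers p) : ℂ_[p]) L →
    Module.IsTorsion (IwasawaAlgebra p) (Castella2018.AcSelmer.XAc (W.baseChange K) p κ vbar ∅ γ) ∧
      (Castella2018.AcSelmer.XAc.charIdeal (W.baseChange K) p κ vbar ∅ γ).map (PowerSeries.map (toUnr p)) =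
        Ideal.span {L}

variable {W p} in
omit [W.IsElliptic] in
/-- **KY's printed proof of Thm. 3.0.8 (IMC2), in the kernel: ONE DIVISIBILITY (L-div, PUB∘) + `μ = 0`
and `λ`-EQUALITY (L-μλ, PRE) ⟹ the EQUALITY of ideals** (MEMO-1 L9; the companion file's
`span_singleton_eq_of_C_pow_mul_mem`). [cite: KellerYin2024, proof of Thm. 3.0.8 (TeX L1631–L1640)] -/
theorem goodLatticeIMCEqOnTree_of_div_of_muLambda (hdiv : GoodLatticeDivOnTree W p)
    (hml : GoodLatticeMuLambdaOnTree W p) : GoodLatticeIMCEqOnTree W p := by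
  intro hp hgood hred han hGL K _ _ hK hHN hHp hodd h3 hEK hSel ι v vbar hv hvbar hne κ hκ γ _ N _ Dt H
    ιC P hP ι' hι' ΩK Ωp L hΩK hL
  obtain ⟨htors, k, hk⟩ := hdiv hp hgood hred han hGL K hK hHN hHp hodd h3 hEK hSel ι v vbar hv hvbar hne
    κ hκ γ N Dt H ιC P hP ι' hι' ΩK Ωp L hΩK hL
  obtain ⟨F, hF⟩ :=
    (charIdeal_isPrincipal_holds p (Castella2018.AcSelmer.XAc (W.baseChange K) p κ vbar ∅ γ)).principal
  have hchar : Castella2018.AcSelmer.XAc.charIdeal (W.baseChange K) p κ vbar ∅ γ = Ideal.span {F} := hF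
  obtain ⟨n, hFn, hLn⟩ := hml hp hgood hred han hGL K hK hHN hHp hodd h3 hEK hSel ι v vbar hv hvbar hne
    κ hκ γ N Dt H ιC P hP ι' hι' ΩK Ωp L hΩK hL F hchar
  rw [hchar, Ideal.map_span, Set.image_singleton] at hk ⊢
  exact ⟨htors, span_singleton_eq_of_C_pow_mul_mem hk hFn hLn⟩

end Shapes

/-! ## §2 The four inputs imply `h308` -/

/-- **`h308` from (IMC2) proper + the two published BDP inputs.** H1 (existence of the frame, PUB
shape) + (IMC2) as an equality of ideals of `R₀⟦T⟧` (`GoodLatticeIMCEqOnTree`, KY Thm. 3.0.8 proper)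
+ L-val (BDP value at `𝟙`, PUB) ⟹ `KellerYin2024.thm308_imc2_bdpValue_goodLattice_OPEN` — [CGLS]
(5.4) read back in `ℚ_p` (`exists_unit_constantCoeff_eq`); the characteristic ideal of any `Λ`-module is
principal (tree: `charIdeal_isPrincipal_holds`). CONDITIONAL on the named inputs; nothing booked.
[cite: CastellaGrossiLeeSkinner2022, Thm. 5.1.3, proof of Thm. 5.3.1 (5.4)]
[cite: KellerYin2024, Thm. 3.0.8 (IMC2)] -/
theorem thm308_of_imcEq
    (hH1 : ∀ (W : WeierstrassCurve ℚ) [W.IsElliptic] [W.IsGloballyMinimal] (p : ℕ) [Fact p.Prime],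
      GoodBDPExistsOnTree W p)
    (himc : ∀ (W : WeierstrassCurve ℚ) [W.IsElliptic] [W.IsGloballyMinimal] (p : ℕ) [Fact p.Prime],
      GoodLatticeIMCEqOnTree W p)
    (hval : ∀ (W : WeierstrassCurve ℚ) [W.IsElliptic] [W.IsGloballyMinimal] (p : ℕ) [Fact p.Prime],
      GoodBDPValueOnTree W p) :
    thm308_imc2_bdpValue_goodLattice_OPEN := by
  intro W _ _ p _ hp hgood hred han hGL K _ _ hK hHN hHp hodd h3 hEK hSel ι v vbar hv hvbar hne κ hκ γ _
    N _ Dt H ιC P hP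
  -- H1: a frame `L` of the BDP `p`-adic `L`-function at `v`
  obtain ⟨ι', hι', ΩK, Ωp, L, hΩK, hL⟩ := hH1 W p hp hgood hred han hGL K hK hHN hHp hodd h3 hEK hSel ι
    v vbar hv hvbar hne κ hκ γ N Dt H ιC P hP
  -- (IMC2): torsion and `char(𝔛) · R₀⟦T⟧ = (L)`
  obtain ⟨htors, heq⟩ := himc W p hp hgood hred han hGL K hK hHN hHp hodd h3 hEK hSel ι v vbar hv hvbar
    hne κ hκ γ N Dt H ιC P hP ι' hι' ΩK Ωp L hΩK hL
  -- a generator `F` of the (principal) characteristic ideal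
  obtain ⟨F, hF⟩ :=
    (charIdeal_isPrincipal_holds p (Castella2018.AcSelmer.XAc (W.baseChange K) p κ vbar ∅ γ)).principal
  have hchar : Castella2018.AcSelmer.XAc.charIdeal (W.baseChange K) p κ vbar ∅ γ = Ideal.span {F} := hF
  rw [hchar, Ideal.map_span, Set.image_singleton] at heq
  -- L-val and (5.4) read back in `ℚ_p`
  obtain ⟨w, hw⟩ := hval W p hp hgood hred han hGL K hK hHN hHp hodd h3 hEK hSel ι v vbar hv hvbar hne
    κ hκ γ N Dt H ιC P hP ι' hι' ΩK Ωp L hΩK hL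
  obtain ⟨u, hu⟩ := exists_unit_constantCoeff_eq heq w hw
  refine ⟨htors, F, hchar, u, ?_⟩
  rw [hu]
  ring

/-- **`h308` from its inside.** H1 (existence of the BDP frame, PUB shape) + L-div (one divisibility
after inverting `p`, PUB∘) + L-μλ (`μ = 0` and `λ`-equality at an anomalous prime — Keller–Yin's new
content, PRE) + L-val (BDP value at `𝟙`, PUB) ⟹ `KellerYin2024.thm308_imc2_bdpValue_goodLattice_OPEN`:
`goodLatticeIMCEqOnTree_of_div_of_muLambda` (MEMO-1 L9 in the kernel) then `thm308_of_imcEq`. So the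
preprint content of THEOREM A (row A1) is confined to the ONE statement `GoodLatticeMuLambdaOnTree`.
CONDITIONAL on the four named inputs; nothing booked, no label moves.
[cite: KellerYin2024, Thm. 3.0.8 (IMC2), proof (TeX L1631–L1640)]
[cite: CastellaGrossiLeeSkinner2022, Prop. 4.2.1, Thm. 5.1.3, proof of Thm. 5.3.1 (5.4)] -/
theorem thm308_of_halves
    (hH1 : ∀ (W : WeierstrassCurve ℚ) [W.IsElliptic] [W.IsGloballyMinimal] (p : ℕ) [Fact p.Prime],
      GoodBDPExistsOnTree W p)
    (hdiv : ∀ (W : WeierstrassCurve ℚ) [W.IsElliptic] [W.IsGloballyMinimal] (p : ℕ) [Fact p.Prime],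
      GoodLatticeDivOnTree W p)
    (hml : ∀ (W : WeierstrassCurve ℚ) [W.IsElliptic] [W.IsGloballyMinimal] (p : ℕ) [Fact p.Prime],
      GoodLatticeMuLambdaOnTree W p)
    (hval : ∀ (W : WeierstrassCurve ℚ) [W.IsElliptic] [W.IsGloballyMinimal] (p : ℕ) [Fact p.Prime],
      GoodBDPValueOnTree W p) :
    thm308_imc2_bdpValue_goodLattice_OPEN :=
  thm308_of_imcEq hH1 (fun W _ _ p _ ↦ goodLatticeIMCEqOnTree_of_div_of_muLambda (hdiv W p) (hml W p))
    hval

end Summit.BirchSwinnertonDyer.Rank1Residual.X1.KellerYinHalves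

end
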